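import Literature.Barriers.CriticalPhenomena.LaceExpansionXSpaceAsymptotics
import Literature.Probability.Percolation.InfraredTriangleAnalysis
import HarnessLib

/-!
# The lace expansion at `p_c`: `Hara2008_laceExpansionPc` split along its printed seam

Barrier catalogue `Literature/Barriers/CriticalPhenomena/` (D-0021), companion of
`LaceExpansionXSpaceAsymptotics.lean`. That file vendors the named fact

* `Hara2008_laceExpansionPc` — for bond percolation on `ℤ^d`, `d ≥ 11`, there is a `ℤ^d`-symmetric
  lace-expansion coefficient `Π = Π_{p_c}` with `|Π(x)| ≤ c ⟦x⟧^{-2(d-2)}`, `Ĵ(0) = 1`, the infrared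
  lower bound `c₁|k|²/d ≤ 1 - Ĵ(k)` and the representation
  `τ_{p_c}(0,x) = ∫_{[-π,π]^d} e^{ikx} ĝ(k)/(1 - Ĵ(k)) dk/(2π)^d` (`g = δ₀ + Π`, `J = 2dp_c D ⋆ g`),

whose printed proof is a theory (triage: XL). It has two halves with disjoint sources:

* the **`k`-space half** — Hara 2008, Prop. 1.2 at `p = p_c` (the Hara–Slade expansion, its
  convergence, the bounds on `Π_p` and `Ĵ_p`, `Ĵ_{p_c}(0) = 1`, and Appendix A for the passage
  `p ↑ p_c`; for `11 ≤ d ≤ 18` the convergence is the computer-assisted NoBLE analysis of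
  Fitzner–van der Hofstad 2017, Thm. 1.1, §2.6 and §7; Heydenreich–van der Hofstad 2017, (11.2.4)
  and Thm. 10.1), vendored here as `Hara2008_prop12Pc`;
* the **`x`-space half** — Hara 2008, §1.2.3–§1.2.4: Lemmas 1.5–1.7, Thm. 1.3 and the iteration
  `φ₀ = 2 ↦ φ = d - 4 - ε` give `G(x) ≤ c⟦x⟧^{-(d-4-ε)}`, enough for the sufficient condition
  `G(x) ≤ c⟦x⟧^{-(d+2)/2}` iff `d > 10`, whence `|Π(x)| ≤ c⟦x⟧^{-2(d-2)}` (Heydenreich–van der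
  Hofstad (11.2.13); for `d ≥ 11` Fitzner–van der Hofstad 2017, Thm. 1.4 and its proof, §2.6:
  "we show that the classical lace expansion actually also converges, and we prove sufficient
  bounds on the classical lace-expansion coefficients"), vendored here as
  `Hara2008_xSpacePiBoundPc`.

The `x`-space half is stated for EVERY `Φ` having the `k`-space properties
(`IsLaceCoefficientPc d Φ`), not for "the" `Π_{p_c} = Σ_n (-1)^n Π^{(n)}_{p_c}` of Hara–Slade, which
is not constructed in this library. This is legitimate because such a `Φ` is UNIQUE — proved
below (`IsLaceCoefficientPc.unique`): if `Φ₁, Φ₂` both represent `τ_{p_c}`, then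
`F_i = ĝ_i/(1 - Ĵ_i)` are integrable on the cube (`τ > 0` forces it) with the same Fourier
coefficients, so `(1 - Ĵ₁)(1 - Ĵ₂)(F₁ - F₂)` — which is `ĝ₁ - ĝ₂` off `k = 0` because
`Ĵ_i = 2p_c (Σ_j cos k_j) ĝ_i` — has vanishing coefficients (multiplying an integrable function
with vanishing coefficients by an absolutely convergent trigonometric series keeps them vanishing),
and Fourier inversion for `ℓ¹(ℤ^d)` gives `g₁ = g₂`. Consequently the split is lossless:
`Hara2008_laceExpansionPc ↔ Hara2008_prop12Pc ∧ Hara2008_xSpacePiBoundPc`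
(`hara2008_laceExpansionPc_iff`).

## Contents

* `IsLaceCoefficientPc d Φ` — the conclusions of Prop. 1.2 at `p = p_c` used downstream;
* NAMED FACTS `Hara2008_prop12Pc`, `Hara2008_xSpacePiBoundPc`;
* PROVED: lattice Fourier toolkit on `[-π,π]^d` (`continuous_latticeFT`, `norm_latticeFT_le`,
  shift covariance `latticeFT_comp_add_right`, `Ĵ = 2p (Σ_j cos k_j) ĝ` (`latticeFT_laceKernel`),
  inversion `integral_cexp_kdot_mul_latticeFT`, and the annihilation lemma
  `integral_cexp_kdot_mul_latticeFT_mul_eq_zero`); `IsLaceCoefficientPc.integrableOn`,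
  `IsLaceCoefficientPc.unique`; the assembly `Hara2008_laceExpansionPc_of_inputs` and the
  equivalence `hara2008_laceExpansionPc_iff`.

What remains for `Hara2008_laceExpansionPc_holds` is exactly the two named facts.

## References

* T. Hara, Ann. Probab. 36 (2008) 530–593 (arXiv:math-ph/0504021): §1.1 Notation (Fourier
  transform and inversion on `[-π,π]^d`); Prop. 1.2 (representation of `G_p`, `p ≤ p_c`;
  `D̂`, `Ĵ_p`, `ĝ_p`, `Π_p`; the bounds `0 ≤ Π^{(n)}_p ≤ h^{(n)}`, `Σ_x Σ_n h^{(n)} ≤ c/d`,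
  `Σ_x |x|²|Π_p(x)| ≤ c/d`, `c₁|k|²/d ≤ Ĵ_p(0) - Ĵ_p(k) ≤ c₂|k|²/d`; "`Ĵ_{p_c}(0) = 1`");
  §1.2 ("complete proof … only for large `d` (say `d ≥ 30`) for percolation"); §1.2.3
  (Lemma 1.5; the sufficient condition `G(x) ≤ c⟦x⟧^{-α}`, `α = (d+2)/2` for percolation; the
  bound `|Π(x)| ≤ c⟦x⟧^{-2(d-2)}`, `ρ = d - 6`); §1.2.4 (Lemmas 1.6–1.7 and the recursion for
  percolation: "This is sufficient … as long as `(d+2)/2 < d-4-ε`, or `d > 10`"); Appendix A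
  (items 1–4: extension to `p = p_c`, the display `G_{p_c}(x) = lim_{p↑p_c} G_p(x) = ∫ e^{ikx}
  ĝ_{p_c}(k)/(1 - Ĵ_{p_c}(k)) d^dk/(2π)^d`; Lemma A.1).
* M. Heydenreich, R. van der Hofstad, *Progress in High-Dimensional Percolation and Random
  Graphs*, Springer 2017: Thm. 11.4, (11.2.4), (11.2.13)–(11.2.14), p. 139; Thm. 10.1.
* R. Fitzner, R. van der Hofstad, Electron. J. Probab. 22 (2017) no. 43: Thm. 1.1, Thm. 1.4 and
  its proof (§7), §2.6 ("Proof of related results and the classical lace expansion": "we show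
  that the classical lace expansion actually also converges … Remarkably, we thus see that for
  `d = 11`, we cannot directly prove that the classical lace expansion converges, but we can prove
  it after we have obtained sharp estimates on the two-point function in `k`-space and on
  `p_c(11)` using the NoBLE").

Not here: the Hara–Slade coefficients `Π^{(n)}_p` themselves (nested expectations over coupled
configurations), the diagrammatic Lemmas 1.5–1.6, the analytic Lemma 1.7 and Thm. 1.3 — the finer
decomposition of the two halves, which needs those objects.
-/

noncomputable section

namespace Literature.Barriers.CriticalPhenomena

open _root_.MeasureTheory _root_.Filter Literature.Probability.LatticeModels
  Literature.Probability.Percolation Literature.Barriers.CriticalPhenomena.Slade2006Prop53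

variable {d : ℕ}

/-! ### The two halves as named facts -/

/-- **`Φ` is a lace-expansion coefficient function for critical bond percolation on `ℤ^d`**: the
conclusions of Hara's Prop. 1.2 at `p = p_c` that the `x`-space analysis consumes, for a function
`Φ = Π_{p_c} : ℤ^d → ℝ` with `g = δ₀ + Π` (`laceSource Φ`) and `J = 2dp_c D ⋆ g`
(`laceKernel p_c Φ`): `Π` is `ℤ^d`-symmetric and absolutely summable (Prop. 1.2:
`|Π_p(x)| ≤ Σ_n Π^{(n)}_p(x) ≤ Σ_n h^{(n)}(x)`, `Σ_x Σ_n h^{(n)}(x) ≤ c/d`);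
`Ĵ_{p_c}(0) = Σ_x J(x) = 1` ("the critical point is characterized by `Ĵ_{p_c}(0) = 1`"); the
infrared lower bound `c₁|k|²/d ≤ Ĵ(0) - Ĵ(k)` on `[-π,π]^d` (the `k`-space bounds of Prop. 1.2
at `p = p_c`; `Ĵ` is real, the bound is written on the real part); and the representation
`τ_{p_c}(0,x) = ∫_{[-π,π]^d} e^{ikx} ĝ(k)/(1 - Ĵ(k)) dk/(2π)^d` for all `x` (the representation
of Prop. 1.2 at `p = p_c`, a Lebesgue integral: Appendix A, item 4). Such a `Φ` is unique
(`IsLaceCoefficientPc.unique`).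
[cite: Hara2008, Prop. 1.2 (representation of G_p; bounds on Π_p; k-space bounds; Ĵ_{p_c}(0) = 1) and Appendix A (item 4)] -/
structure IsLaceCoefficientPc (d : ℕ) (Φ : Site d → ℝ) : Prop where
  /-- `Π` is `ℤ^d`-symmetric. -/
  symm : IsZdSymmetric Φ
  /-- `Σ_x |Π(x)| < ∞`. -/
  summable_abs : Summable fun x => |Φ x|
  /-- `Ĵ_{p_c}(0) = Σ_x J(x) = 1`. -/
  hasSum_one : HasSum (laceKernel (criticalProbI d) Φ) 1
  /-- The infrared lower bound `c₁ |k|²/d ≤ 1 - Ĵ(k)` on `[-π,π]^d`, `c₁ > 0`. -/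
  lower : ∃ c₁ : ℝ, 0 < c₁ ∧ ∀ k ∈ cube d,
    c₁ * (∑ i, k i ^ 2) / d ≤ 1 - (latticeFT (laceKernel (criticalProbI d) Φ) k).re
  /-- `τ_{p_c}(0,x) = H(x) = ∫ e^{ikx} ĝ(k)/(1 - Ĵ(k)) dk/(2π)^d` for every `x`. -/
  repr : ∀ x : Site d, ((tau d (criticalProbI d) 0 x : ℝ) : ℂ) =
    haraH (laceKernel (criticalProbI d) Φ) (laceSource Φ) x

/-- NAMED FACT — **the `k`-space half: Hara's Prop. 1.2 at `p = p_c` for percolation, `d ≥ 11`**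
("for percolation in `d ≥ 19` … the two-point function for `p ≤ p_c` is represented as
`G_p(x) = ∫ e^{ikx} ĝ_p(k)/(1 - Ĵ_p(k)) d^dk/(2π)^d`, `Ĵ_p = 2dp D̂{1 + Π̂_p}`, `ĝ_p = 1 + Π̂_p` …
`Σ_x |x|² |Π_p(x)| ≤ c/d`, `c₁|k|²/d ≤ Ĵ_p(0) - Ĵ_p(k)` … The critical point is characterized by
`Ĵ_{p_c}(0) = 1`"; at `p = p_c` by Appendix A; for `11 ≤ d ≤ 18` by the NoBLE analysis —
Heydenreich–van der Hofstad 2017, Thm. 10.1 ("uniformly for `p ≤ p_c`") and (11.2.4), p. 139;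
Fitzner–van der Hofstad 2017, Thm. 1.1 and §7): for every `d ≥ 11` there is a `Φ` with
`IsLaceCoefficientPc d Φ` and `Σ_x |x|² |Φ(x)| < ∞`. The constants are allowed to depend on `d`
(Hara prints `c, c₁` independent of `d` for `d ≥ 19`). Not vendored: the infrared bound
`0 ≤ Ĝ_p ≤ cd/|k|²`, the diagram bounds `W̄, T̄ < λ`, `H̄ < c`, `λ ≤ c₃/d`, `1 ≤ 2dp_c ≤ 1 + c₄λ`
and the upper bound `Ĵ_p(0) - Ĵ_p(k) ≤ c₂|k|²/d`. Users take `(h : Hara2008_prop12Pc)`.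
[cite: Hara2008, Prop. 1.2 and Appendix A (items 1–4)]
[cite: HeydenreichVanDerHofstad2017, Thm. 10.1, (11.2.4) and p. 139]
[cite: FitznerVanDerHofstad2017, Thm. 1.1, §2.6 ("we show that the classical lace expansion actually also converges") and §7 (proof of Thm. 1.4)] -/
def Hara2008_prop12Pc : Prop :=
  ∀ (d : ℕ), 11 ≤ d → ∃ Φ : Site d → ℝ, IsLaceCoefficientPc d Φ ∧
    Summable fun x => euclidNorm x ^ 2 * |Φ x|

/-- NAMED FACT — **the `x`-space half: the bound on `Π_{p_c}` for percolation, `d ≥ 11`**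
(Hara 2008, §1.2.3: "We can then use (the Gaussian asymptotics of Thm. 1.3) as an input to
Lemma 1.5, and get `|Π(x)| ≤ c⟦x⟧^{-2(d-2)}` (percolation)", obtained from Prop. 1.2 through
Lemmas 1.5–1.7, Thm. 1.3
and the recursion of §1.2.4, which closes iff `d > 10`; Heydenreich–van der Hofstad 2017,
(11.2.13); for `11 ≤ d ≤ 18` Fitzner–van der Hofstad 2017, Thm. 1.4, whose proof "follows by
verifying that the conditions that Hara poses in [Hara08] … are satisfied"). Stated for every `Φ`
with `IsLaceCoefficientPc d Φ`; by `IsLaceCoefficientPc.unique` this is the statement about the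
lace-expansion coefficient of the sources. Scope caveat as printed: Hara's text gives complete
details "only for large `d` (say `d ≥ 30`)"; `d ≥ 19` rests on estimates announced in Hara–Slade
1994, `d ≥ 11` on the NoBLE numerics and "a recent improvement of the bounds by Hara" (Fitzner–van
der Hofstad 2017, §7). Users take `(h : Hara2008_xSpacePiBoundPc)`.
[cite: Hara2008, §1.2.3 (Lemma 1.5 and the bound |Π(x)| ≤ c⟦x⟧^{-2(d-2)} for percolation) and §1.2.4 (Lemmas 1.6–1.7; "(d+2)/2 < d-4-ε, or d > 10")]
[cite: HeydenreichVanDerHofstad2017, (11.2.13) and p. 139]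
[cite: FitznerVanDerHofstad2017, Thm. 1.4 and its proof (§7)] -/
def Hara2008_xSpacePiBoundPc : Prop :=
  ∀ (d : ℕ), 11 ≤ d → ∀ Φ : Site d → ℝ, IsLaceCoefficientPc d Φ →
    ∃ c : ℝ, ∀ x, |Φ x| ≤ c / jnorm x ^ (2 * ((d : ℝ) - 2))

/-- **Assembly**: the two halves give `Hara2008_laceExpansionPc` (Hara's §1.2: Prop. 1.2 at
`p = p_c` together with the `x`-space bound on `Π` of §1.2.3). [cite: Hara2008, §1.2.1–§1.2.3] -/
theorem Hara2008_laceExpansionPc_of_inputs (h₁ : Hara2008_prop12Pc)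
    (h₂ : Hara2008_xSpacePiBoundPc) : Hara2008_laceExpansionPc := by
  intro d hd
  obtain ⟨Φ, hΦ, -⟩ := h₁ d hd
  exact ⟨Φ, hΦ.symm, h₂ d hd Φ hΦ, hΦ.hasSum_one, hΦ.lower, hΦ.repr⟩


/-! ### Lattice Fourier analysis on `[-π,π]^d`: continuity, shifts, inversion, annihilation -/

/-- The terms of `f̂(k)` have norm `|f(x)|`. [folklore] -/
theorem norm_latticeFT_term (a : Site d → ℝ) (k : Fin d → ℝ) (x : Site d) :
    ‖(a x : ℂ) * Complex.exp (-(Complex.I * (kdot k x : ℂ)))‖ = |a x| := by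
  rw [norm_mul, Complex.norm_real, Complex.norm_exp, Real.norm_eq_abs]
  simp

/-- `|f̂(k)| ≤ Σ_x |f(x)|`. [folklore] -/
theorem norm_latticeFT_le {a : Site d → ℝ} (ha : Summable fun x => |a x|) (k : Fin d → ℝ) :
    ‖latticeFT a k‖ ≤ ∑' x, |a x| := by
  unfold latticeFT
  refine (norm_tsum_le_tsum_norm ?_).trans (le_of_eq (tsum_congr fun x => norm_latticeFT_term a k x))
  exact (summable_latticeFT_term ha k).norm

/-- `f̂` is continuous for absolutely summable `f` (uniform convergence). [folklore] -/
theorem continuous_latticeFT {a : Site d → ℝ} (ha : Summable fun x => |a x|) :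
    Continuous (latticeFT a) := by
  unfold latticeFT
  refine continuous_tsum (fun x => ?_) ha fun x k => le_of_eq (norm_latticeFT_term a k x)
  have hk : Continuous fun k : Fin d → ℝ => kdot k x := by unfold kdot; fun_prop
  exact continuous_const.mul (Complex.continuous_exp.comp
    ((Complex.continuous_ofReal.comp hk).const_mul _).neg)

/-- `k · eᵢ = kᵢ`. [folklore] -/
theorem kdot_single_right (k : Fin d → ℝ) (i : Fin d) :
    kdot k (Pi.single i (1 : ℤ) : Site d) = k i := by
  unfold kdot
  rw [Finset.sum_eq_single i]
  · simp
  · intro j _ hj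
    simp [Pi.single_eq_of_ne hj]
  · intro h
    exact absurd (Finset.mem_univ i) h

/-- **Shift covariance**: the transform of `y ↦ f(y + v)` is `e^{ik·v} f̂(k)` (a reindexing of the
sum; no summability needed). [folklore] -/
theorem latticeFT_comp_add_right (a : Site d → ℝ) (v : Site d) (k : Fin d → ℝ) :
    latticeFT (fun y => a (y + v)) k = Complex.exp (Complex.I * (kdot k v : ℂ)) * latticeFT a k := by
  unfold latticeFT
  rw [← tsum_mul_left, ← (Equiv.subRight v).tsum_eq]
  refine tsum_congr fun z => ?_
  have hz : kdot k (z - v) = kdot k z - kdot k v := by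
    rw [sub_eq_add_neg, kdot_add, kdot_neg, ← sub_eq_add_neg]
  simp only [Equiv.subRight_apply, sub_add_cancel, hz]
  rw [mul_left_comm, ← Complex.exp_add]
  congr 2
  push_cast
  ring

/-- `Σ_y f(y + v) e^{-ik·y}` is absolutely summable when `f` is. [folklore] -/
theorem summable_abs_comp_add_right {a : Site d → ℝ} (ha : Summable fun x => |a x|) (v : Site d) :
    Summable fun y => |a (y + v)| :=
  (Equiv.addRight v).summable_iff.2 ha

/-- Linearity: `(c f)^ = c f̂` (no summability needed). [folklore] -/
theorem latticeFT_const_mul (c : ℝ) (a : Site d → ℝ) (k : Fin d → ℝ) :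
    latticeFT (fun y => c * a y) k = (c : ℂ) * latticeFT a k := by
  unfold latticeFT
  rw [← tsum_mul_left]
  refine tsum_congr fun y => ?_
  push_cast
  ring

/-- Linearity: `(f + g)^ = f̂ + ĝ` for absolutely summable `f, g`. [folklore] -/
theorem latticeFT_add {a b : Site d → ℝ} (ha : Summable fun x => |a x|)
    (hb : Summable fun x => |b x|) (k : Fin d → ℝ) :
    latticeFT (fun y => a y + b y) k = latticeFT a k + latticeFT b k := by
  unfold latticeFT
  rw [← Summable.tsum_add (summable_latticeFT_term ha k) (summable_latticeFT_term hb k)]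
  refine tsum_congr fun y => ?_
  push_cast
  ring

/-- Linearity: `(f - g)^ = f̂ - ĝ` for absolutely summable `f, g`. [folklore] -/
theorem latticeFT_sub {a b : Site d → ℝ} (ha : Summable fun x => |a x|)
    (hb : Summable fun x => |b x|) (k : Fin d → ℝ) :
    latticeFT (fun y => a y - b y) k = latticeFT a k - latticeFT b k := by
  unfold latticeFT
  rw [← Summable.tsum_sub (summable_latticeFT_term ha k) (summable_latticeFT_term hb k)]
  refine tsum_congr fun y => ?_
  push_cast
  ring

/-- Linearity: the transform of a finite sum of absolutely summable functions. [folklore] -/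
theorem latticeFT_finset_sum {ι : Type*} (s : Finset ι) {f : ι → Site d → ℝ}
    (hf : ∀ i ∈ s, Summable fun x => |f i x|) (k : Fin d → ℝ) :
    latticeFT (fun y => ∑ i ∈ s, f i y) k = ∑ i ∈ s, latticeFT (f i) k := by
  unfold latticeFT
  rw [← Summable.tsum_finsetSum (fun i hi => summable_latticeFT_term (hf i hi) k)]
  refine tsum_congr fun y => ?_
  push_cast
  rw [Finset.sum_mul]

/-- `e^{iu} + e^{-iu} = 2 cos u` in the form used for `D̂`. [folklore] -/
theorem cexp_I_mul_add_cexp_neg (u : ℝ) :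
    Complex.exp (Complex.I * (u : ℂ)) + Complex.exp (Complex.I * ((-u : ℝ) : ℂ)) =
      ((2 * Real.cos u : ℝ) : ℂ) := by
  push_cast
  rw [Complex.two_cos]
  ring_nf

/-- **`Ĵ(k) = 2p (Σ_j cos k_j) ĝ(k) = 2dp D̂(k) ĝ(k)`** for the percolation kernel
`J = 2dp D ⋆ g` (`laceKernel p Φ`, `g = laceSource Φ` absolutely summable).
[cite: Hara2008, Prop. 1.2 (Ĵ_p = 2dp D̂ {1 + Π̂_p}, ĝ_p = 1 + Π̂_p, D̂(k) = d⁻¹ Σ_j cos k_j)] -/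
theorem latticeFT_laceKernel {Φ : Site d → ℝ} (hg : Summable fun x => |laceSource Φ x|) (p : ℝ)
    (k : Fin d → ℝ) :
    latticeFT (laceKernel p Φ) k =
      ((2 * p * ∑ i, Real.cos (k i) : ℝ) : ℂ) * latticeFT (laceSource Φ) k := by
  set g := laceSource Φ with hg_def
  have hsub : ∀ (i : Fin d) (y : Site d),
      y - (Pi.single i (1 : ℤ) : Site d) = y + (Pi.single i (-1 : ℤ) : Site d) := fun i y => by
    rw [sub_eq_add_neg, ← Pi.single_neg]
  have hker : laceKernel p Φ = fun y =>
      p * ∑ i, (g (y + (Pi.single i (1 : ℤ) : Site d)) + g (y + (Pi.single i (-1 : ℤ) : Site d))) := by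
    funext y
    simp only [laceKernel, hsub, ← hg_def]
  have hsi : ∀ i : Fin d,
      Summable fun y => |g (y + (Pi.single i (1 : ℤ) : Site d)) + g (y + (Pi.single i (-1 : ℤ) : Site d))| := by
    intro i
    refine Summable.of_nonneg_of_le (fun _ => abs_nonneg _) (fun y => abs_add_le _ _) ?_
    exact (summable_abs_comp_add_right hg _).add (summable_abs_comp_add_right hg _)
  have hneg : ∀ i : Fin d, kdot k ((Pi.single i (-1 : ℤ) : Site d)) = -k i := fun i => by
    rw [show ((Pi.single i (-1 : ℤ) : Site d) : Site d) = -Pi.single i 1 from (Pi.single_neg i 1),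
      kdot_neg, kdot_single_right]
  rw [hker, latticeFT_const_mul, latticeFT_finset_sum _ (fun i _ => hsi i)]
  rw [Finset.sum_congr rfl fun i _ => by
    rw [latticeFT_add (summable_abs_comp_add_right hg _) (summable_abs_comp_add_right hg _),
      latticeFT_comp_add_right, latticeFT_comp_add_right, ← add_mul, kdot_single_right, hneg,
      cexp_I_mul_add_cexp_neg]]
  rw [← Finset.sum_mul, ← mul_assoc]
  congr 1
  push_cast
  rw [Finset.mul_sum, Finset.mul_sum]
  refine Finset.sum_congr rfl fun i _ => ?_
  ring

/-- The cube `[-π,π]^d` is measurable. [folklore] -/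
theorem measurableSet_cube (d : ℕ) : MeasurableSet (cube d) :=
  MeasurableSet.univ_pi fun _ => measurableSet_Icc

/-- `‖e^{i k·y}‖ = 1`. [folklore] -/
theorem norm_cexp_I_mul_kdot (k : Fin d → ℝ) (y : Site d) :
    ‖Complex.exp (Complex.I * (kdot k y : ℂ))‖ = 1 := by
  rw [Complex.norm_exp]
  simp

/-- `k ↦ e^{i k·y}` is continuous. [folklore] -/
theorem continuous_cexp_I_mul_kdot (y : Site d) :
    Continuous fun k : Fin d → ℝ => Complex.exp (Complex.I * (kdot k y : ℂ)) := by
  have hk : Continuous fun k : Fin d → ℝ => kdot k y := by unfold kdot; fun_prop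
  exact Complex.continuous_exp.comp ((Complex.continuous_ofReal.comp hk).const_mul _)

/-- Multiplying an integrable function on the cube by the character `e^{ik·y}` keeps it
integrable. [folklore] -/
theorem integrableOn_cexp_kdot_mul {G : (Fin d → ℝ) → ℂ} (hG : IntegrableOn G (cube d)) (y : Site d) :
    IntegrableOn (fun k => Complex.exp (Complex.I * (kdot k y : ℂ)) * G k) (cube d) :=
  Integrable.bdd_mul (c := 1) hG (continuous_cexp_I_mul_kdot y).aestronglyMeasurable
    (Eventually.of_forall fun k => (norm_cexp_I_mul_kdot k y).le)

/-- Multiplying an integrable function on the cube by `f̂` (`f ∈ ℓ¹`) keeps it integrable.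
[folklore] -/
theorem integrableOn_latticeFT_mul {a : Site d → ℝ} (ha : Summable fun x => |a x|)
    {G : (Fin d → ℝ) → ℂ} (hG : IntegrableOn G (cube d)) :
    IntegrableOn (fun k => latticeFT a k * G k) (cube d) :=
  Integrable.bdd_mul (c := ∑' x, |a x|) hG (continuous_latticeFT ha).aestronglyMeasurable
    (Eventually.of_forall fun k => norm_latticeFT_le ha k)

/-- **Fourier inversion for `ℓ¹(ℤ^d)`**: `∫_{[-π,π]^d} e^{ik·y} f̂(k) dk = (2π)^d f(y)` for
absolutely summable `f` (term-by-term integration, dominated by `(2π)^d Σ|f|`, and orthogonality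
of the characters). [cite: Hara2008, §1.1 Notation (f̂(k) = Σ_x f(x) e^{-ik·x}, f(x) = ∫ e^{ik·x} f̂(k) d^dk/(2π)^d "when both equations make sense")] -/
theorem integral_cexp_kdot_mul_latticeFT {a : Site d → ℝ} (ha : Summable fun x => |a x|)
    (y : Site d) :
    ∫ k in cube d, Complex.exp (Complex.I * (kdot k y : ℂ)) * latticeFT a k =
      ((2 * Real.pi) ^ d : ℂ) * (a y : ℂ) := by
  classical
  rw [show (volume.restrict (cube d) : Measure (Fin d → ℝ)) = P d from volume_restrict_cube d]
  set F : Site d → (Fin d → ℝ) → ℂ := fun x k =>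
    (a x : ℂ) * Complex.exp (-(Complex.I * (kdot k (x - y) : ℂ))) with hF
  have hsub : ∀ (k : Fin d → ℝ) (x : Site d), kdot k (x - y) = kdot k x - kdot k y := fun k x => by
    rw [sub_eq_add_neg, kdot_add, kdot_neg, ← sub_eq_add_neg]
  have hexp : ∀ k, Complex.exp (Complex.I * (kdot k y : ℂ)) * latticeFT a k = ∑' x, F x k := by
    intro k
    unfold latticeFT
    rw [← tsum_mul_left]
    refine tsum_congr fun x => ?_
    simp only [hF, hsub]
    rw [mul_left_comm, ← Complex.exp_add]
    congr 2
    push_cast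
    ring
  simp_rw [hexp]
  have hFm : ∀ x, AEStronglyMeasurable (F x) (P d) := by
    intro x
    refine Continuous.aestronglyMeasurable ?_
    have hk : Continuous fun k : Fin d → ℝ => kdot k (x - y) := by unfold kdot; fun_prop
    exact continuous_const.mul (Complex.continuous_exp.comp
      ((Complex.continuous_ofReal.comp hk).const_mul _).neg)
  have hFnorm : ∀ x k, ‖F x k‖ₑ = ‖a x‖ₑ := by
    intro x k
    rw [← ofReal_norm, ← ofReal_norm, hF]
    dsimp only
    rw [norm_mul, Complex.norm_real, Complex.norm_exp, Real.norm_eq_abs]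
    simp
  have hsum : ∑' x, ∫⁻ k, ‖F x k‖ₑ ∂P d ≠ ⊤ := by
    simp_rw [hFnorm, lintegral_const]
    rw [ENNReal.tsum_mul_right]
    refine ENNReal.mul_ne_top ?_ (measure_ne_top _ _)
    have : ∑' x, ‖a x‖ₑ = ENNReal.ofReal (∑' x, |a x|) := by
      rw [ENNReal.ofReal_tsum_of_nonneg (fun _ => abs_nonneg _) ha]
      refine tsum_congr fun x => ?_
      rw [← ofReal_norm, Real.norm_eq_abs]
    rw [this]
    exact ENNReal.ofReal_ne_top
  rw [integral_tsum hFm hsum]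
  have hterm : ∀ x, ∫ k, F x k ∂P d =
      (a x : ℂ) * (if x - y = 0 then ((2 * Real.pi) ^ d : ℂ) else 0) := by
    intro x
    simp only [hF]
    rw [integral_const_mul, integral_cexp_neg_kdot]
  simp_rw [hterm]
  rw [tsum_eq_single y]
  · rw [sub_self, if_pos rfl, mul_comm]
  · intro x hx
    rw [if_neg (sub_ne_zero.2 hx), mul_zero]

/-- **Annihilation lemma**: if `G` is integrable on the cube and all its Fourier coefficients
`∫ e^{ik·y} G(k) dk` (`y ∈ ℤ^d`) vanish, then so do those of `f̂ · G` for every `f ∈ ℓ¹(ℤ^d)`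
(expand `f̂`, integrate term by term — dominated by `Σ|f| ∫|G|` — and use the hypothesis at
`y - x`). [folklore] -/
theorem integral_cexp_kdot_mul_latticeFT_mul_eq_zero {a : Site d → ℝ} (ha : Summable fun x => |a x|)
    {G : (Fin d → ℝ) → ℂ} (hG : IntegrableOn G (cube d))
    (h0 : ∀ y : Site d, ∫ k in cube d, Complex.exp (Complex.I * (kdot k y : ℂ)) * G k = 0)
    (y : Site d) :
    ∫ k in cube d, Complex.exp (Complex.I * (kdot k y : ℂ)) * (latticeFT a k * G k) = 0 := by
  set μ : Measure (Fin d → ℝ) := volume.restrict (cube d) with hμ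
  set F : Site d → (Fin d → ℝ) → ℂ := fun x k =>
    (a x : ℂ) * (Complex.exp (Complex.I * (kdot k (y - x) : ℂ)) * G k) with hF
  have hexp : ∀ k, Complex.exp (Complex.I * (kdot k y : ℂ)) * (latticeFT a k * G k) =
      ∑' x, F x k := by
    intro k
    unfold latticeFT
    rw [← tsum_mul_right, ← tsum_mul_left]
    refine tsum_congr fun x => ?_
    have hsub : kdot k (y - x) = kdot k y - kdot k x := by
      rw [sub_eq_add_neg, kdot_add, kdot_neg, ← sub_eq_add_neg]
    simp only [hF, hsub]
    have : Complex.exp (Complex.I * ((kdot k y - kdot k x : ℝ) : ℂ)) =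
        Complex.exp (Complex.I * (kdot k y : ℂ)) * Complex.exp (-(Complex.I * (kdot k x : ℂ))) := by
      rw [← Complex.exp_add]
      congr 1
      push_cast
      ring
    rw [this]
    ring
  change ∫ k, Complex.exp (Complex.I * (kdot k y : ℂ)) * (latticeFT a k * G k) ∂μ = 0
  simp_rw [hexp]
  have hFm : ∀ x, AEStronglyMeasurable (F x) μ := fun x =>
    (((continuous_cexp_I_mul_kdot (y - x)).aestronglyMeasurable).mul hG.aestronglyMeasurable).const_mul _
  have hFnorm : ∀ x k, ‖F x k‖ₑ = ‖a x‖ₑ * ‖G k‖ₑ := by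
    intro x k
    rw [← ofReal_norm, ← ofReal_norm, ← ofReal_norm, ← ENNReal.ofReal_mul (norm_nonneg _)]
    congr 1
    rw [hF]
    dsimp only
    rw [norm_mul, norm_mul, Complex.norm_real, norm_cexp_I_mul_kdot, one_mul, Real.norm_eq_abs]
  have hsum : ∑' x, ∫⁻ k, ‖F x k‖ₑ ∂μ ≠ ⊤ := by
    simp_rw [hFnorm]
    have hx : ∀ x, ∫⁻ k, ‖a x‖ₑ * ‖G k‖ₑ ∂μ = ‖a x‖ₑ * ∫⁻ k, ‖G k‖ₑ ∂μ := fun x =>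
      lintegral_const_mul' _ _ enorm_ne_top
    simp_rw [hx]
    rw [ENNReal.tsum_mul_right]
    refine ENNReal.mul_ne_top ?_ hG.hasFiniteIntegral.ne
    have : ∑' x, ‖a x‖ₑ = ENNReal.ofReal (∑' x, |a x|) := by
      rw [ENNReal.ofReal_tsum_of_nonneg (fun _ => abs_nonneg _) ha]
      refine tsum_congr fun x => ?_
      rw [← ofReal_norm, Real.norm_eq_abs]
    rw [this]
    exact ENNReal.ofReal_ne_top
  rw [integral_tsum hFm hsum]
  have hterm : ∀ x, ∫ k, F x k ∂μ = 0 := by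
    intro x
    simp only [hF]
    rw [integral_const_mul]
    change (a x : ℂ) * ∫ k in cube d, Complex.exp (Complex.I * (kdot k (y - x) : ℂ)) * G k = 0
    rw [h0 (y - x), mul_zero]
  simp_rw [hterm]
  exact tsum_zero

/-! ### Integrability and uniqueness of the lace-expansion coefficient at `p_c` -/

/-- `g = δ₀ + Π` is absolutely summable when `Π` is. [folklore] -/
theorem summable_abs_laceSource {Φ : Site d → ℝ} (hΦ : Summable fun x => |Φ x|) :
    Summable fun x => |laceSource Φ x| := by
  have h0 : Summable (fun x : Site d => |(if x = 0 then (1 : ℝ) else 0)|) :=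
    summable_of_ne_finset_zero (s := {0}) fun x hx => by
      rw [Finset.mem_singleton] at hx
      rw [if_neg hx, abs_zero]
  refine Summable.of_nonneg_of_le (fun _ => abs_nonneg _) (fun x => ?_) (h0.add hΦ)
  exact abs_add_le _ _

/-- `J = 2dp D ⋆ g` is absolutely summable when `Π` is. [folklore] -/
theorem summable_abs_laceKernel {Φ : Site d → ℝ} (hΦ : Summable fun x => |Φ x|) (p : ℝ) :
    Summable fun x => |laceKernel p Φ x| :=
  (summable_laceKernel (summable_abs_iff.1 (summable_abs_laceSource hΦ)) p).abs

/-- **The representation forces integrability**: under `IsLaceCoefficientPc d Φ` (`d ≥ 1`) the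
integrand `e^{ikx} ĝ(k)/(1 - Ĵ(k))` of `H(x)` is integrable on the cube — otherwise the Bochner
integral would vanish, whereas `τ_{p_c}(0,x) > 0`. (Hara, Appendix A item 4: "the integrand is
integrable in `k` … thanks to the infrared bound".) [cite: Hara2008, Appendix A (item 4)] -/
theorem IsLaceCoefficientPc.integrableOn {Φ : Site d → ℝ} (h : IsLaceCoefficientPc d Φ) (hd : 1 ≤ d)
    (x : Site d) :
    IntegrableOn (haraIntegrand (laceKernel (criticalProbI d) Φ) (laceSource Φ) x) (cube d) := by
  by_contra hni
  have h0 : haraH (laceKernel (criticalProbI d) Φ) (laceSource Φ) x = 0 := by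
    unfold haraH
    rw [integral_undef hni, zero_div]
  have h1 := h.repr x
  rw [h0, Complex.ofReal_eq_zero] at h1
  exact (tau_criticalProbI_pos hd 0 x).ne' h1

/-- In particular `F = ĝ/(1 - Ĵ)` itself (the case `x = 0`) is integrable on the cube.
[cite: Hara2008, Appendix A (item 4)] -/
theorem IsLaceCoefficientPc.integrableOn_ratio {Φ : Site d → ℝ} (h : IsLaceCoefficientPc d Φ)
    (hd : 1 ≤ d) :
    IntegrableOn (fun k => latticeFT (laceSource Φ) k /
      (1 - latticeFT (laceKernel (criticalProbI d) Φ) k)) (cube d) := by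
  refine (h.integrableOn hd 0).congr_fun (fun k _ => ?_) (measurableSet_cube d)
  simp [haraIntegrand]

/-- The Fourier coefficients of `F = ĝ/(1 - Ĵ)` are `(2π)^d τ_{p_c}(0,·)`.
[cite: Hara2008, Prop. 1.2 (representation of G_p) and Appendix A (item 4)] -/
theorem IsLaceCoefficientPc.integral_eq {Φ : Site d → ℝ} (h : IsLaceCoefficientPc d Φ) (x : Site d) :
    ∫ k in cube d, haraIntegrand (laceKernel (criticalProbI d) Φ) (laceSource Φ) x k =
      ((2 * Real.pi) ^ d : ℂ) * ((tau d (criticalProbI d) 0 x : ℝ) : ℂ) := by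
  have hc : ((2 * Real.pi : ℂ)) ^ d ≠ 0 :=
    pow_ne_zero _ (mul_ne_zero two_ne_zero (Complex.ofReal_ne_zero.2 Real.pi_ne_zero))
  have h1 := h.repr x
  unfold haraH at h1
  rw [h1, mul_div_cancel₀ _ hc]

/-- The infrared lower bound makes `1 - Ĵ(k) ≠ 0` for `k ∈ [-π,π]^d ∖ {0}`.
[cite: Hara2008, Prop. 1.2 (k-space lower bound c₁|k|²/d ≤ Ĵ_p(0) - Ĵ_p(k))] -/
theorem IsLaceCoefficientPc.one_sub_latticeFT_ne_zero {Φ : Site d → ℝ} (h : IsLaceCoefficientPc d Φ)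
    (hd : 1 ≤ d) {k : Fin d → ℝ} (hk : k ∈ cube d) (hk0 : k ≠ 0) :
    (1 : ℂ) - latticeFT (laceKernel (criticalProbI d) Φ) k ≠ 0 := by
  obtain ⟨c₁, hc₁, hlow⟩ := h.lower
  have hS : 0 < ∑ i, k i ^ 2 := by
    obtain ⟨j, hj⟩ : ∃ j, k j ≠ 0 := by
      by_contra hne
      push Not at hne
      exact hk0 (funext hne)
    exact lt_of_lt_of_le (by positivity) (Finset.single_le_sum (fun i _ => sq_nonneg (k i))
      (Finset.mem_univ j))
  have hd' : (0 : ℝ) < d := by exact_mod_cast hd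
  have hpos : 0 < 1 - (latticeFT (laceKernel (criticalProbI d) Φ) k).re :=
    lt_of_lt_of_le (by positivity) (hlow k hk)
  intro hz
  have := congrArg Complex.re hz
  simp only [Complex.sub_re, Complex.one_re, Complex.zero_re] at this
  linarith

/-- **Uniqueness of the lace-expansion coefficient at `p_c`.** Two functions `Φ₁, Φ₂` with
`IsLaceCoefficientPc d Φᵢ` (`d ≥ 1`) coincide: `Fᵢ = ĝᵢ/(1 - Ĵᵢ)` are integrable with equal
Fourier coefficients `(2π)^d τ_{p_c}`, so `G = F₁ - F₂` is annihilated by every character; by the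
annihilation lemma so is `M = (1 - Ĵ₁)(1 - Ĵ₂) G`, which equals `ĝ₁ - ĝ₂` off `k = 0` because
`Ĵᵢ = 2p_c (Σ_j cos k_j) ĝᵢ`; Fourier inversion for `g₁ - g₂ ∈ ℓ¹` gives `g₁ = g₂`. Hence the
`x`-space named fact, stated for all such `Φ`, is a statement about the coefficient of the
sources. [folklore] -/
theorem IsLaceCoefficientPc.unique (hd : 1 ≤ d) {Φ₁ Φ₂ : Site d → ℝ} (h₁ : IsLaceCoefficientPc d Φ₁)
    (h₂ : IsLaceCoefficientPc d Φ₂) : Φ₁ = Φ₂ := by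
  set p : ℝ := (criticalProbI d : ℝ) with hp
  set g₁ := laceSource Φ₁ with hg₁_def
  set g₂ := laceSource Φ₂ with hg₂_def
  set J₁ := laceKernel p Φ₁ with hJ₁_def
  set J₂ := laceKernel p Φ₂ with hJ₂_def
  have hg₁ : Summable fun x => |g₁ x| := summable_abs_laceSource h₁.summable_abs
  have hg₂ : Summable fun x => |g₂ x| := summable_abs_laceSource h₂.summable_abs
  have hJ₁ : Summable fun x => |J₁ x| := summable_abs_laceKernel h₁.summable_abs p
  have hJ₂ : Summable fun x => |J₂ x| := summable_abs_laceKernel h₂.summable_abs p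
  -- the two ratios and their difference
  set F₁ : (Fin d → ℝ) → ℂ := fun k => latticeFT g₁ k / (1 - latticeFT J₁ k) with hF₁
  set F₂ : (Fin d → ℝ) → ℂ := fun k => latticeFT g₂ k / (1 - latticeFT J₂ k) with hF₂
  have hiF₁ : IntegrableOn F₁ (cube d) := h₁.integrableOn_ratio hd
  have hiF₂ : IntegrableOn F₂ (cube d) := h₂.integrableOn_ratio hd
  set G : (Fin d → ℝ) → ℂ := fun k => F₁ k - F₂ k with hG
  have hiG : IntegrableOn G (cube d) := hiF₁.sub hiF₂
  have hcoef : ∀ y : Site d,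
      ∫ k in cube d, Complex.exp (Complex.I * (kdot k y : ℂ)) * F₁ k =
        ∫ k in cube d, Complex.exp (Complex.I * (kdot k y : ℂ)) * F₂ k := by
    intro y
    have e₁ := h₁.integral_eq y
    have e₂ := h₂.integral_eq y
    simp only [haraIntegrand] at e₁ e₂
    rw [e₁, e₂]
  have hG0 : ∀ y : Site d, ∫ k in cube d, Complex.exp (Complex.I * (kdot k y : ℂ)) * G k = 0 := by
    intro y
    simp only [hG, mul_sub]
    rw [integral_sub (integrableOn_cexp_kdot_mul hiF₁ y) (integrableOn_cexp_kdot_mul hiF₂ y),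
      hcoef y, sub_self]
  -- first annihilation: `G' = (1 - Ĵ₂) G`
  set G' : (Fin d → ℝ) → ℂ := fun k => (1 - latticeFT J₂ k) * G k with hG'
  have hiG' : IntegrableOn G' (cube d) := by
    have h := hiG.sub (integrableOn_latticeFT_mul hJ₂ hiG)
    refine h.congr_fun (fun k _ => ?_) (measurableSet_cube d)
    simp only [hG', Pi.sub_apply]
    ring
  have hG'0 : ∀ y : Site d, ∫ k in cube d, Complex.exp (Complex.I * (kdot k y : ℂ)) * G' k = 0 := by
    intro y
    have e : (fun k => Complex.exp (Complex.I * (kdot k y : ℂ)) * G' k) = fun k =>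
        Complex.exp (Complex.I * (kdot k y : ℂ)) * G k -
          Complex.exp (Complex.I * (kdot k y : ℂ)) * (latticeFT J₂ k * G k) := by
      funext k
      simp only [hG']
      ring
    rw [e, integral_sub (integrableOn_cexp_kdot_mul hiG y)
      (integrableOn_cexp_kdot_mul (integrableOn_latticeFT_mul hJ₂ hiG) y), hG0 y,
      integral_cexp_kdot_mul_latticeFT_mul_eq_zero hJ₂ hiG hG0 y, sub_self]
  -- second annihilation: `M = (1 - Ĵ₁) G'`
  set M : (Fin d → ℝ) → ℂ := fun k => (1 - latticeFT J₁ k) * G' k with hM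
  have hM0 : ∀ y : Site d, ∫ k in cube d, Complex.exp (Complex.I * (kdot k y : ℂ)) * M k = 0 := by
    intro y
    have e : (fun k => Complex.exp (Complex.I * (kdot k y : ℂ)) * M k) = fun k =>
        Complex.exp (Complex.I * (kdot k y : ℂ)) * G' k -
          Complex.exp (Complex.I * (kdot k y : ℂ)) * (latticeFT J₁ k * G' k) := by
      funext k
      simp only [hM]
      ring
    rw [e, integral_sub (integrableOn_cexp_kdot_mul hiG' y)
      (integrableOn_cexp_kdot_mul (integrableOn_latticeFT_mul hJ₁ hiG') y), hG'0 y,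
      integral_cexp_kdot_mul_latticeFT_mul_eq_zero hJ₁ hiG' hG'0 y, sub_self]
  -- `M = ĝ₁ - ĝ₂` off the origin
  have hrel₁ : ∀ k, latticeFT J₁ k = ((2 * p * ∑ i, Real.cos (k i) : ℝ) : ℂ) * latticeFT g₁ k :=
    fun k => latticeFT_laceKernel hg₁ p k
  have hrel₂ : ∀ k, latticeFT J₂ k = ((2 * p * ∑ i, Real.cos (k i) : ℝ) : ℂ) * latticeFT g₂ k :=
    fun k => latticeFT_laceKernel hg₂ p k
  have hMeq : ∀ k ∈ cube d, k ≠ 0 → M k = latticeFT g₁ k - latticeFT g₂ k := by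
    intro k hk hk0
    have hu₁ := h₁.one_sub_latticeFT_ne_zero hd hk hk0
    have hu₂ := h₂.one_sub_latticeFT_ne_zero hd hk hk0
    rw [← hJ₁_def, hrel₁ k] at hu₁
    rw [← hJ₂_def, hrel₂ k] at hu₂
    simp only [hM, hG', hG, hF₁, hF₂, hrel₁ k, hrel₂ k]
    field_simp
    ring
  have hae : ∀ᵐ k ∂(volume.restrict (cube d) : Measure (Fin d → ℝ)), k ∈ cube d ∧ k ≠ 0 := by
    have h1 : ∀ᵐ k ∂(volume.restrict (cube d) : Measure (Fin d → ℝ)), k ∈ cube d :=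
      ae_restrict_mem (measurableSet_cube d)
    have h2 : ∀ᵐ k ∂(volume.restrict (cube d) : Measure (Fin d → ℝ)), k ∈ ({0} : Set (Fin d → ℝ))ᶜ := by
      rw [show (volume.restrict (cube d) : Measure (Fin d → ℝ)) = P d from volume_restrict_cube d]
      exact compl_mem_ae_iff.2 (P_singleton_zero hd)
    filter_upwards [h1, h2] with k hk hk0
    exact ⟨hk, hk0⟩
  -- inversion: `g₁ = g₂`
  have hgsub : Summable fun x => |g₁ x - g₂ x| := by
    refine Summable.of_nonneg_of_le (fun _ => abs_nonneg _) (fun x => abs_sub _ _) (hg₁.add hg₂)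
  have hgeq : ∀ y : Site d, g₁ y = g₂ y := by
    intro y
    have hinv := integral_cexp_kdot_mul_latticeFT hgsub y
    have hint : ∫ k in cube d, Complex.exp (Complex.I * (kdot k y : ℂ)) *
        latticeFT (fun x => g₁ x - g₂ x) k = 0 := by
      rw [← hM0 y]
      refine integral_congr_ae ?_
      filter_upwards [hae] with k hk
      rw [hMeq k hk.1 hk.2, latticeFT_sub hg₁ hg₂]
    rw [hint] at hinv
    have hc : ((2 * Real.pi : ℂ)) ^ d ≠ 0 :=
      pow_ne_zero _ (mul_ne_zero two_ne_zero (Complex.ofReal_ne_zero.2 Real.pi_ne_zero))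
    have h0 : ((g₁ y - g₂ y : ℝ) : ℂ) = 0 := by
      have := hinv.symm
      rwa [mul_eq_zero, or_iff_right hc] at this
    have h0' : g₁ y - g₂ y = 0 := by exact_mod_cast h0
    linarith
  funext y
  have h := hgeq y
  simp only [hg₁_def, hg₂_def, laceSource] at h
  linarith

/-! ### The split is lossless -/

/-- From the `x`-space bound: absolute summability of `Π` (`2(d-2) > d` for `d > 4`).
[folklore] -/
theorem summable_abs_of_xSpaceBound {Φ : Site d → ℝ} (hd : 5 ≤ d) {c : ℝ}
    (hc : ∀ x, |Φ x| ≤ c / jnorm x ^ (2 * ((d : ℝ) - 2))) : Summable fun x => |Φ x| :=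
  summable_abs_of_decay hc (by
    have : (5 : ℝ) ≤ d := by exact_mod_cast hd
    linarith)

/-- From the `x`-space bound: the second moment `Σ_x |x|² |Π(x)| < ∞` (`2(d-2) - 2 > d` for
`d > 6`), the quantity `Σ_x |x|²|Π_p(x)|` of Prop. 1.2. [cite: Hara2008, Prop. 1.2 (Σ_x |x|²|Π_p(x)| ≤ c/d)] -/
theorem summable_sq_mul_abs_of_xSpaceBound {Φ : Site d → ℝ} (hd : 7 ≤ d) {c : ℝ}
    (hc : ∀ x, |Φ x| ≤ c / jnorm x ^ (2 * ((d : ℝ) - 2))) :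
    Summable fun x => euclidNorm x ^ 2 * |Φ x| := by
  have hd' : (7 : ℝ) ≤ d := by exact_mod_cast hd
  have h := summable_rpow_mul_abs_of_decay hc (a := 2) (by norm_num) (by linarith)
  refine h.congr fun x => ?_
  rw [show (2 : ℝ) = ((2 : ℕ) : ℝ) by norm_num, Real.rpow_natCast]

/-- **Losslessness of the split**: `Hara2008_laceExpansionPc` is equivalent to the conjunction of
its two halves (the forward direction uses the uniqueness of the coefficient).
[cite: Hara2008, §1.2.1–§1.2.3] -/
theorem hara2008_laceExpansionPc_iff :
    Hara2008_laceExpansionPc ↔ (Hara2008_prop12Pc ∧ Hara2008_xSpacePiBoundPc) := by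
  constructor
  · intro h
    constructor
    · intro d hd
      obtain ⟨Φ, hsymm, ⟨c, hc⟩, hJ1, hlow, hrepr⟩ := h d hd
      exact ⟨Φ, ⟨hsymm, summable_abs_of_xSpaceBound (by omega) hc, hJ1, hlow, hrepr⟩,
        summable_sq_mul_abs_of_xSpaceBound (by omega) hc⟩
    · intro d hd Φ hΦ
      obtain ⟨Ψ, hsymm, ⟨c, hc⟩, hJ1, hlow, hrepr⟩ := h d hd
      have hΨ : IsLaceCoefficientPc d Ψ :=
        ⟨hsymm, summable_abs_of_xSpaceBound (by omega) hc, hJ1, hlow, hrepr⟩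
      rw [hΦ.unique (by omega) hΨ]
      exact ⟨c, hc⟩
  · rintro ⟨h₁, h₂⟩
    exact Hara2008_laceExpansionPc_of_inputs h₁ h₂

end Literature.Barriers.CriticalPhenomena
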